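import Summits.ValiantsHypothesis.ValiantsHypothesis.Theorems.BarrierLeverAnchoredDoorHitsLowerPairsGapOneFace
import Summits.ValiantsHypothesis.ValiantsHypothesis.Theorems.BarrierLeverAnchoredDoorHitsLowerPairsSwap

/-!
# Support item `AnchoredDoorHitsLowerPairs` (stmt-ValiantsHypothesis-22510), line `anchored-peeling`:
# THE FACE-TARGET GAP-ONE STEP — induction form and strong-induction MOVE (both sides)

Helper file (`--supports stmt-ValiantsHypothesis-22510`; cell valiant-natproofs, rung V4, 𝒟-side door (c); registered line
`Cruxes/AnchoredDoorHitsLowerPairs/Lines/anchored_peeling.lean` v13; prover seat val-np-p1 gen 19). Definition-free. Closes NO item.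

The face-target gap-one theorem `symbolicDet_ne_zero_of_gapOneFace` (file `…GapOneFace`, p621942; the `m = 1` case of the registered `Stmt.stub_uqFaceStep`)
restated (i) with hypotheses = symbolic minors of ENUMERATIONS of the reduced deletion pair `({S ∈ R : a ∉ S} ∖ {u i₀}, {T ∈ C : F ⊄ T})` and reduced link pair
`(lk_a R, {T ∖ F : T ⊇ F} ∖ {w j₀ ∖ F})` (pattern of `…GapOneStep`), and (ii) as a MOVE on injective LOWER pairs: if a vertex `a` and a face `F = {c} ∪ D` of the
other complex (`|F| ≤ s`) have `#{i : a ∉ u i} = #{j : F ⊄ w j} + 1`, the strong induction hypothesis on lower pairs with fewer rows gives `symbolicDet ≠ 0`;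
(iii) the same with the two sides exchanged (`symbolicDet_ne_zero_comm`).

WHAT THIS IS NOT: gaps `m ≥ 2`; nothing on crux stmt-ValiantsHypothesis-14610 or on `VP` versus `VNP`.
-/

set_option linter.dupNamespace false

open Matrix

namespace Summit.ValiantsHypothesis.ValiantsHypothesis.Theorems.BarrierLever.AnchoredPeeling

open Finset MvPolynomial
open Summit.ValiantsHypothesis.ValiantsHypothesis.Theorems.BarrierLever.BrickCalculus (pexpo pexpo_def pexpo_le_iff pexpo_sub)

noncomputable section

variable {s h r : ℕ} {u w : Fin r → Finset (Fin h)} {a c : Fin h} {D : Finset (Fin h)}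

/-- **THE FACE-TARGET GAP-ONE STEP, induction form.** -/
theorem symbolicDet_ne_zero_of_gapOneFace' (hs : 1 ≤ s) (hu : Function.Injective u) (hw : Function.Injective w)
    (hcD : c ∉ D) (hF : (insert c D).card ≤ s) (hw0 : ∃ j, w j = ∅)
    (hgap : Fintype.card {i : Fin r // ¬ (a ∈ u i)} = Fintype.card {j : Fin r // ¬ (insert c D ⊆ w j)} + 1)
    (i₀ : Fin r) (hi₀ : a ∉ u i₀)
    (H1 : ∀ (r₁ : ℕ) (u₁ w₁ : Fin r₁ → Finset (Fin h)), Function.Injective u₁ → Function.Injective w₁ →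
      Set.range u₁ = {S | S ∈ Set.range u ∧ a ∉ S ∧ S ≠ u i₀} → Set.range w₁ = {T | T ∈ Set.range w ∧ ¬ (insert c D ⊆ T)} →
      symbolicDet s h r₁ u₁ w₁ ≠ 0)
    (j₀ : Fin r) (hj₀ : insert c D ⊆ w j₀)
    (H2 : ∀ (r₂ : ℕ) (u₂ w₂ : Fin r₂ → Finset (Fin h)), Function.Injective u₂ → Function.Injective w₂ →
      Set.range u₂ = {S | a ∉ S ∧ insert a S ∈ Set.range u} →
      Set.range w₂ = {T | Disjoint T (insert c D) ∧ T ∪ insert c D ∈ Set.range w ∧ T ∪ insert c D ≠ w j₀} →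
      symbolicDet s h r₂ u₂ w₂ ≠ 0) :
    symbolicDet s h r u w ≠ 0 := by
  classical
  -- the four reindexings
  set n := Fintype.card {j : Fin r // ¬ (insert c D ⊆ w j)} with hn
  set n' := Fintype.card {i : Fin r // a ∈ u i} with hn'
  have hcardC : Fintype.card {j : Fin r // ¬ ¬ (insert c D ⊆ w j)} = n' + 1 := by
    have h1 := Fintype.card_subtype_compl (fun i : Fin r => a ∈ u i)
    have h2 := Fintype.card_subtype_compl (fun j : Fin r => ¬ (insert c D ⊆ w j))
    have h3 : Fintype.card {j : Fin r // ¬ (insert c D ⊆ w j)} ≤ Fintype.card (Fin r) := Fintype.card_subtype_le _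
    have h4 : Fintype.card {i : Fin r // a ∈ u i} ≤ Fintype.card (Fin r) := Fintype.card_subtype_le _
    omega
  let eA : {i : Fin r // ¬ (a ∈ u i)} ≃ Fin (n + 1) := Fintype.equivFinOfCardEq hgap
  let eQ : {j : Fin r // ¬ (insert c D ⊆ w j)} ≃ Fin n := Fintype.equivFinOfCardEq rfl
  let eP : {i : Fin r // a ∈ u i} ≃ Fin n' := Fintype.equivFinOfCardEq rfl
  let eC : {j : Fin r // ¬ ¬ (insert c D ⊆ w j)} ≃ Fin (n' + 1) := Fintype.equivFinOfCardEq hcardC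
  let x₀ : Fin (n + 1) := eA ⟨i₀, hi₀⟩
  let y₀ : Fin (n' + 1) := eC ⟨j₀, not_not.mpr hj₀⟩
  refine symbolicDet_ne_zero_of_gapOneFace hs hu hw hcD hF hw0 eA eQ eP eC x₀ ?_ y₀ ?_
  · -- (H1): the tall block minus row x₀ is the symbolic minor of an enumeration of the reduced deletion pair
    let u₁ : Fin n → Finset (Fin h) := fun k => u (eA.symm (x₀.succAbove k)).1
    let w₁ : Fin n → Finset (Fin h) := fun l => w (eQ.symm l).1
    have hmat : (tallBlock (facePeelMatrix s h r u w a c D) (fun i => a ∈ u i) (fun j => ¬ (insert c D ⊆ w j)) eA eQ).submatrix x₀.succAbove id =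
        Matrix.of fun k l => coeff (pexpo (u₁ k) (w₁ l)) (symbolicWitness s h) := by
      refine Matrix.ext (fun k l => ?_)
      show facePeelMatrix s h r u w a c D (eA.symm (x₀.succAbove k)).1 (eQ.symm l).1 = _
      rw [Matrix.of_apply]
      exact facePeelMatrix_del u w a c D (eA.symm (x₀.succAbove k)).2 _
    rw [hmat]
    refine H1 n u₁ w₁ ?_ ?_ ?_ ?_
    · intro k k' hkk
      have := hu hkk
      exact Fin.succAbove_right_injective (eA.symm.injective (Subtype.val_injective this))
    · intro l l' hll
      exact eQ.symm.injective (Subtype.val_injective (hw hll))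
    · ext S
      constructor
      · rintro ⟨k, rfl⟩
        refine ⟨⟨_, rfl⟩, (eA.symm (x₀.succAbove k)).2, fun hS => ?_⟩
        have hidx : (eA.symm (x₀.succAbove k)).1 = i₀ := hu hS
        have : x₀.succAbove k = x₀ := by
          have h' : eA.symm (x₀.succAbove k) = ⟨i₀, hi₀⟩ := Subtype.ext hidx
          rw [← eA.apply_symm_apply (x₀.succAbove k), h']
        exact Fin.succAbove_ne x₀ k this
      · rintro ⟨⟨i, rfl⟩, hai, hne⟩
        have hne' : eA ⟨i, hai⟩ ≠ x₀ := fun h' => hne (by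
          have := congrArg (fun z => (eA.symm z).1) h'
          simp only [Equiv.symm_apply_apply, x₀] at this
          rw [this])
        obtain ⟨k, hk⟩ := Fin.exists_succAbove_eq hne'
        exact ⟨k, by show u (eA.symm (x₀.succAbove k)).1 = u i; rw [hk, Equiv.symm_apply_apply]⟩
    · ext T
      constructor
      · rintro ⟨l, rfl⟩
        exact ⟨⟨_, rfl⟩, (eQ.symm l).2⟩
      · rintro ⟨⟨j, rfl⟩, hcj⟩
        exact ⟨eQ ⟨j, hcj⟩, by show w (eQ.symm (eQ ⟨j, hcj⟩)).1 = w j; rw [Equiv.symm_apply_apply]⟩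
  · -- (H2): the wide block minus column y₀ is the symbolic minor of an enumeration of the reduced link pair
    let u₂ : Fin n' → Finset (Fin h) := fun k => (u (eP.symm k).1).erase a
    let w₂ : Fin n' → Finset (Fin h) := fun l => w (eC.symm (y₀.succAbove l)).1 \ insert c D
    have hcw : ∀ z : {j : Fin r // ¬ ¬ (insert c D ⊆ w j)}, insert c D ⊆ w z.1 := fun z => not_not.mp z.2
    have hmat : (wideBlock (facePeelMatrix s h r u w a c D) (fun i => a ∈ u i) (fun j => ¬ (insert c D ⊆ w j)) eP eC).submatrix id y₀.succAbove =
        Matrix.of fun k l => coeff (pexpo (u₂ k) (w₂ l)) (symbolicWitness s h) := by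
      refine Matrix.ext (fun k l => ?_)
      show facePeelMatrix s h r u w a c D (eP.symm k).1 (eC.symm (y₀.succAbove l)).1 = _
      rw [Matrix.of_apply]
      exact facePeelMatrix_link_of_mem u w a c D (eP.symm k).2 (hcw _)
    rw [hmat]
    have herase_u : ∀ z z' : {i : Fin r // a ∈ u i}, (u z.1).erase a = (u z'.1).erase a → z = z' := by
      intro z z' hzz
      apply Subtype.ext; apply hu
      rw [← Finset.insert_erase z.2, ← Finset.insert_erase z'.2, hzz]
    have herase_w : ∀ z z' : {j : Fin r // ¬ ¬ (insert c D ⊆ w j)}, w z.1 \ insert c D = w z'.1 \ insert c D → z = z' := by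
      intro z z' hzz
      apply Subtype.ext; apply hw
      rw [← Finset.sdiff_union_of_subset (hcw z), ← Finset.sdiff_union_of_subset (hcw z'), hzz]
    refine H2 n' u₂ w₂ ?_ ?_ ?_ ?_
    · intro k k' hkk
      exact eP.symm.injective (herase_u _ _ hkk)
    · intro l l' hll
      exact Fin.succAbove_right_injective (eC.symm.injective (herase_w _ _ hll))
    · ext S
      constructor
      · rintro ⟨k, rfl⟩
        refine ⟨Finset.notMem_erase a _, ⟨(eP.symm k).1, ?_⟩⟩
        show u (eP.symm k).1 = insert a ((u (eP.symm k).1).erase a)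
        rw [Finset.insert_erase (eP.symm k).2]
      · rintro ⟨haS, ⟨i, hi⟩⟩
        have hai : a ∈ u i := by rw [hi]; exact Finset.mem_insert_self a S
        refine ⟨eP ⟨i, hai⟩, ?_⟩
        show (u (eP.symm (eP ⟨i, hai⟩)).1).erase a = S
        rw [Equiv.symm_apply_apply, hi, Finset.erase_insert haS]
    · ext T
      constructor
      · rintro ⟨l, rfl⟩
        refine ⟨Finset.sdiff_disjoint, ⟨(eC.symm (y₀.succAbove l)).1, ?_⟩, fun hT => ?_⟩
        · show w (eC.symm (y₀.succAbove l)).1 = w (eC.symm (y₀.succAbove l)).1 \ insert c D ∪ insert c D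
          rw [Finset.sdiff_union_of_subset (hcw _)]
        · rw [Finset.sdiff_union_of_subset (hcw _)] at hT
          have hidx : (eC.symm (y₀.succAbove l)).1 = j₀ := hw hT
          have : y₀.succAbove l = y₀ := by
            have h' : eC.symm (y₀.succAbove l) = ⟨j₀, not_not.mpr hj₀⟩ := Subtype.ext hidx
            rw [← eC.apply_symm_apply (y₀.succAbove l), h']
          exact Fin.succAbove_ne y₀ l this
      · rintro ⟨hdT, ⟨j, hj⟩, hne⟩
        have hcj : insert c D ⊆ w j := by rw [hj]; exact Finset.subset_union_right
        have hne' : eC ⟨j, not_not.mpr hcj⟩ ≠ y₀ := fun h' => hne (by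
          have := congrArg (fun z => (eC.symm z).1) h'
          simp only [Equiv.symm_apply_apply, y₀] at this
          rw [← hj, this])
        obtain ⟨l, hl⟩ := Fin.exists_succAbove_eq hne'
        refine ⟨l, ?_⟩
        show w (eC.symm (y₀.succAbove l)).1 \ insert c D = T
        rw [hl, Equiv.symm_apply_apply, hj, Finset.union_sdiff_cancel_right hdT]


/-- In a nonempty finite family of finsets (indexed by a subtype) some member is ⊆-maximal (a member of maximal cardinality). -/
private theorem exists_subset_maximal' {ι : Type*} [Fintype ι] (v : ι → Finset (Fin h)) (P : ι → Prop) [DecidablePred P]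
    (hne : ∃ i, P i) : ∃ i₀, P i₀ ∧ ∀ i, P i → v i₀ ⊆ v i → v i = v i₀ := by
  classical
  have hne' : (Finset.univ.filter P).Nonempty := by
    obtain ⟨i, hi⟩ := hne
    exact ⟨i, Finset.mem_filter.mpr ⟨Finset.mem_univ _, hi⟩⟩
  obtain ⟨i₀, hi₀, hmax⟩ := Finset.exists_max_image (Finset.univ.filter P) (fun i => (v i).card) hne'
  refine ⟨i₀, (Finset.mem_filter.mp hi₀).2, fun i hi hsub => ?_⟩
  exact (Finset.eq_of_subset_of_card_le hsub (hmax i (Finset.mem_filter.mpr ⟨Finset.mem_univ _, hi⟩))).symm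

/-- **THE FACE-TARGET GAP-ONE MOVE (x-vertex `a` onto the y-face `{c} ∪ D`).** -/
theorem symbolicDet_ne_zero_of_gapOneFace_lower (hs : 1 ≤ s) (hu : Function.Injective u) (hw : Function.Injective w)
    (hlu : IsLowerSet (Set.range u)) (hlw : IsLowerSet (Set.range w)) (hcD : c ∉ D) (hF : (insert c D).card ≤ s)
    (hgap : Fintype.card {i : Fin r // ¬ (a ∈ u i)} = Fintype.card {j : Fin r // ¬ (insert c D ⊆ w j)} + 1)
    (IH : ∀ r' < r, ∀ (u' w' : Fin r' → Finset (Fin h)), Function.Injective u' → Function.Injective w' →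
      IsLowerSet (Set.range u') → IsLowerSet (Set.range w') → symbolicDet s h r' u' w' ≠ 0) :
    symbolicDet s h r u w ≠ 0 := by
  classical
  -- cardinal bookkeeping
  have hcardC : Fintype.card {j : Fin r // ¬ ¬ (insert c D ⊆ w j)} = Fintype.card {i : Fin r // a ∈ u i} + 1 := by
    have h1 := Fintype.card_subtype_compl (fun i : Fin r => a ∈ u i)
    have h2 := Fintype.card_subtype_compl (fun j : Fin r => ¬ (insert c D ⊆ w j))
    have h3 : Fintype.card {j : Fin r // ¬ (insert c D ⊆ w j)} ≤ Fintype.card (Fin r) := Fintype.card_subtype_le _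
    have h4 : Fintype.card {i : Fin r // a ∈ u i} ≤ Fintype.card (Fin r) := Fintype.card_subtype_le _
    omega
  -- a ⊆-maximal deletion row and a ⊆-maximal column through c
  have hdel_ne : ∃ i, a ∉ u i := by
    by_contra hno
    push Not at hno
    have : Fintype.card {i : Fin r // ¬ (a ∈ u i)} = 0 := Fintype.card_eq_zero_iff.mpr ⟨fun x => (x.2 (hno x.1)).elim⟩
    omega
  have hstar_ne : ∃ j, insert c D ⊆ w j := by
    by_contra hno
    push Not at hno
    have : Fintype.card {j : Fin r // ¬ ¬ (insert c D ⊆ w j)} = 0 := Fintype.card_eq_zero_iff.mpr ⟨fun x => (x.2 (hno x.1)).elim⟩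
    omega
  obtain ⟨i₀, hi₀, hi₀max⟩ := exists_subset_maximal' u (fun i => a ∉ u i) hdel_ne
  obtain ⟨j₀, hj₀, hj₀max⟩ := exists_subset_maximal' w (fun j => insert c D ⊆ w j) hstar_ne
  -- the column family contains ∅
  have hw0 : ∃ j, w j = ∅ := by
    obtain ⟨j, -⟩ := hstar_ne
    obtain ⟨j', hj'⟩ := hlw (Finset.empty_subset (w j)) ⟨j, rfl⟩
    exact ⟨j', hj'⟩
  refine symbolicDet_ne_zero_of_gapOneFace' hs hu hw hcD hF hw0 hgap i₀ hi₀ ?_ j₀ hj₀ ?_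
  · -- reduced deletion pair: lower, fewer rows
    intro r₁ u₁ w₁ hu₁ hw₁ hru hrw
    have hmem : ∀ k, ∃ i, u i = u₁ k := fun k => by
      have : u₁ k ∈ Set.range u₁ := ⟨k, rfl⟩
      rw [hru] at this
      exact this.1
    choose g hg using hmem
    have hg_inj : Function.Injective g := fun k k' hkk => hu₁ (by rw [← hg k, ← hg k', hkk])
    have hg_ns : ¬ Function.Surjective g := by
      intro hsurj
      obtain ⟨k, hk⟩ := hsurj i₀
      have : u₁ k ∈ Set.range u₁ := ⟨k, rfl⟩
      rw [hru] at this
      exact this.2.2 (by rw [← hg k, hk])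
    have hlt : r₁ < r := by
      have := Fintype.card_lt_of_injective_not_surjective g hg_inj hg_ns
      simpa using this
    refine IH r₁ hlt u₁ w₁ hu₁ hw₁ ?_ ?_
    · intro S S' hS'S hS
      rw [hru] at hS ⊢
      obtain ⟨⟨i, rfl⟩, hai, hne⟩ := hS
      refine ⟨hlu hS'S ⟨i, rfl⟩, fun ha => hai (hS'S ha), fun hS' => ?_⟩
      -- S' = u i₀ ⊆ u i with a ∉ u i forces u i = u i₀
      exact hne (hi₀max i hai (hS' ▸ hS'S))
    · intro T T' hT'T hT
      rw [hrw] at hT ⊢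
      obtain ⟨hT, hcT⟩ := hT
      exact ⟨hlw hT'T hT, fun hc => hcT (hc.trans hT'T)⟩
  · -- reduced link pair: lower, fewer rows
    intro r₂ u₂ w₂ hu₂ hw₂ hru hrw
    have hmem : ∀ k, ∃ i, u i = insert a (u₂ k) := fun k => by
      have : u₂ k ∈ Set.range u₂ := ⟨k, rfl⟩
      rw [hru] at this
      obtain ⟨i, hi⟩ := this.2
      exact ⟨i, hi⟩
    choose g hg using hmem
    have hnot : ∀ k, a ∉ u₂ k := fun k => by
      have : u₂ k ∈ Set.range u₂ := ⟨k, rfl⟩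
      rw [hru] at this
      exact this.1
    have hg_inj : Function.Injective g := fun k k' hkk => hu₂ (by
      have := hg k
      rw [hkk, hg k'] at this
      rw [← Finset.erase_insert (hnot k), ← Finset.erase_insert (hnot k'), this])
    have hg_ns : ¬ Function.Surjective g := by
      intro hsurj
      obtain ⟨k, hk⟩ := hsurj i₀
      exact hi₀ (by rw [← hk, hg k]; exact Finset.mem_insert_self a _)
    have hlt : r₂ < r := by
      have := Fintype.card_lt_of_injective_not_surjective g hg_inj hg_ns
      simpa using this
    refine IH r₂ hlt u₂ w₂ hu₂ hw₂ ?_ ?_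
    · intro S S' hS'S hS
      rw [hru] at hS ⊢
      obtain ⟨haS, ⟨i, hi⟩⟩ := hS
      refine ⟨fun ha => haS (hS'S ha), ?_⟩
      exact hlu (Finset.insert_subset_insert a hS'S) ⟨i, hi⟩
    · intro T T' hT'T hT
      rw [hrw] at hT ⊢
      obtain ⟨hdT, ⟨j, hj⟩, hne⟩ := hT
      refine ⟨Finset.disjoint_of_subset_left hT'T hdT, hlw (Finset.union_subset_union hT'T subset_rfl) ⟨j, hj⟩, fun hT' => ?_⟩
      have hcj : insert c D ⊆ w j := by rw [hj]; exact Finset.subset_union_right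
      have hsub : w j₀ ⊆ w j := by rw [← hT', hj]; exact Finset.union_subset_union hT'T subset_rfl
      exact hne (by rw [← hj, hj₀max j hcj hsub])


/-- **THE FACE-TARGET GAP-ONE MOVE (y-vertex `c` onto the x-face `{a} ∪ B`).** -/
theorem symbolicDet_ne_zero_of_gapOneFace_lower_swap {B : Finset (Fin h)} (hs : 1 ≤ s) (hu : Function.Injective u)
    (hw : Function.Injective w) (hlu : IsLowerSet (Set.range u)) (hlw : IsLowerSet (Set.range w)) (haB : a ∉ B) (hF : (insert a B).card ≤ s)
    (hgap : Fintype.card {j : Fin r // ¬ (c ∈ w j)} = Fintype.card {i : Fin r // ¬ (insert a B ⊆ u i)} + 1)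
    (IH : ∀ r' < r, ∀ (u' w' : Fin r' → Finset (Fin h)), Function.Injective u' → Function.Injective w' →
      IsLowerSet (Set.range u') → IsLowerSet (Set.range w') → symbolicDet s h r' u' w' ≠ 0) :
    symbolicDet s h r u w ≠ 0 := by
  rw [symbolicDet_ne_zero_comm]
  exact symbolicDet_ne_zero_of_gapOneFace_lower hs hw hu hlw hlu haB hF hgap
    (fun r' hr' u' w' hu' hw' hlu' hlw' => (symbolicDet_ne_zero_comm s h r' w' u').mp (IH r' hr' w' u' hw' hu' hlw' hlu'))

end

end Summit.ValiantsHypothesis.ValiantsHypothesis.Theorems.BarrierLever.AnchoredPeeling
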